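import Summits.QuantumFields.BalabanUV.T4Continuum.Spine.NE1p.DressedSmallFieldSlotLettersWitnessEnd
import Summits.QuantumFields.BalabanUV.T4Continuum.Spine.NE1p.DressedSmallFieldOnCoresSlotLettersHermTorus
import Summits.QuantumFields.BalabanUV.T4Continuum.Spine.NE1p.DressedSourceAnalyticSlotLetters

/-!
# T⁴ programme, spine estimate NE1′ (node O3b/H2) — WITNESS W58 «THE SLOT-LETTERS END FIRES ON THE TORUS», PART 3: THE RELETTERED SLOT ENDs
# AND ROW NE5's `TermLineAnalytic` FIRE ON THE SAME DATUM — S36 §1 ((B3) in the `factorMass` currency AT THE FLOOR `m⋆ = 1/2`, `hfloor` WITH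
# EQUALITY), S38 §1 (the Hermitian centre reading: the centre table `[2]` IS Hermitian, `hbud` at `γ^{card} = 2`) and S46 §1
# (`termLineAnalytic_coreLettersOf`) APPLIED ONCE BY NAME each, for EVERY driven two-run object `D`

Cell `pub-balaban`, sub-cell `t4`, row NE1′ formalisation crew (`t4/formal/NE1p/LEAVES.md` row W58 ∕ DAG N29zzzf, typer R-T133 (ii); this PART
answers R-T133 (i)'s OPEN OFFER O-g15 (c) «NE5's `termLineAnalytic_coreLettersOf` FIRED on W58's decided `ActLetters` datum» and adds the two
relettered slot ENDs of this lineage's torus column), unit `b2b-balaban-t4-ne1p-formalise-leaf-04` (LEAF PROVER 04, gen 15).  ADDITIVE —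
imports PART 2 `Spine/NE1p/DressedSmallFieldSlotLettersWitnessEnd` (⇒ PART 1: `AW D`, `PW D`, `tabW D`, `hbase_W`∕`hrdm_W`∕`hrd_W`∕`hctr_W`∕
`hbud_W`∕`hmq_W`; PART 2: `termsW`, `wW`, `actSW`, `lam_real_univ`∕`wB_core`∕`N₁_core`, `letterMass_le`, `hsmall_W`), S38
`Spine/NE1p/DressedSmallFieldOnCoresSlotLettersHermTorus` (leaf-04-g14, p232161; ⇒ S36 `DressedSmallFieldOnCoresSlotLettersMassTorus` p231101, S35,
S32, row NE5's `B13TermCoreMass.factorMass`) and S46 `Spine/NE1p/DressedSourceAnalyticSlotLetters` (leaf-03-g13, p235653; NE5's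
`TermLineAnalytic`, `ballClass`) ONLY — all LANDED; THEOREMS ONLY (0 def, 0 `def … : Prop`, 0 cite, 0 sorry); nothing of S36 ∕ S38 ∕ S46 ∕
PART 1 ∕ PART 2 restated — used BY NAME.

WHAT.
* §8 the floor letters as NAMED LEMMAS: `margin_W` (`(2 − 1·ϑW·1)/2 = 1/2`), **`hfloor_W`** (`m⋆ := 1/2 ≤` S30 §1's margin — WITH EQUALITY),
  `hent_W` ∕ `hco_W` (centre (i) ∕ (iv) read off PART 1's `hctr_W`), **`hherm_W`** (`linForm … 0 a = [2]` IS Hermitian — a real 1×1 matrix),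
  **`hbud_herm_W`** (`detBudget 1 2 ϑW 1 = 1 < γ^{card} = 2^1`);
* §9 **`termLineAnalytic_W`** — S46 §1 ONCE BY NAME: the factor activities of record at `coreLettersOf (AW D)` ARE row NE5's
  `TermLineAnalytic (ballClass ctrW (1/2) 2) … univ` (O-g15 (c));
* §10 on pv22's `tsys 4 N`: **`hF3_W`** — (B3) in row NE5's `factorMass` currency at `m⋆ = 1/2`, MET at `X₀`: by S38 §4's located equality
  `letterMass_eq_factorMass_at_floor` BY NAME the factor mass IS PART 2's letter mass (`letterMass_le`); `hF3_herm_W` (the Hermitian reading's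
  `N₀` letter with `γ^{card} = 2 = d₀` — the same number); **`slotLettersMassEnd_fires_torus`** = S36 §1
  `attachedPart_locE_le_of_coreLettersOf_factorMass_torus D (PW D) ℂ … (AW D)` ONCE BY NAME; **`slotLettersHermEnd_fires_torus`** = S38 §1
  `attachedPart_locE_le_of_coreLettersOf_herm_torus …` ONCE BY NAME — both with PART 2's remaining binders and LITERALLY PART 2's conclusion
  (so PART 2 §6's `slotLettersEnd_live` is their liveness too).

HONEST FRAMING (typer R-T133 wording + rider ADOPTED).  A DECIDED TOY ([folklore]; 0 sorry; 0 citations; no `def … : Prop`): three more face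
theorems of the slot-letters column applied once BY NAME to PART 1's `ActLetters` datum — a vacuity check of S36 §1, S38 §1 and S46 §1 on OUR
1×1 Gaussian table, nothing more; (B3)'s floor form holds BY CHOICE of `rW` and because OUR margin IS the floor — (B3) = G-ne9p2-5 stays
UNPRINTED for Bałaban's cores; the Hermitian reading is trivially met by a REAL 1×1 table (not representative of Bałaban's `C^{(k)}(Z₀,σ)`);
no numeral of [Balaban1988RGII]; 0 binders instantiated on Bałaban's densities; no wall item; wall v1.7 (T4-DAG v47) does NOT move;
R-t4r2-Q2 NOT met thereby; NE1′ ⇐ the named binders — NOT proved, NOT printed; spine PROVED 0∕9; count 9 unchanged.  Rung (B)+1 on ONE finite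
four-torus — NOT infinite volume, NOT a mass gap, NOT OS on ℝ⁴, NOT Clay.  HONEST DEPENDENCY: continuum YM on T⁴ ⇐ BetaPertH ∧ nine spine
estimates (0/9 proved); BetaPertH ⇐ (D1) ∧ (D4) ∧ CAP+tail; G-an2-4 gates asym, D1 and NE2/3/4.
-/

noncomputable section

namespace Summit.QuantumFields.BalabanUV.T4Continuum.NE1p.DressedSmallFieldSlotLettersWitnessMass

open Set Metric MeasureTheory Complex
open scoped BigOperators Matrix
open Literature.MathematicalPhysics.QuantumFieldTheory.Balaban1983to89
open Literature.MathematicalPhysics.QuantumFieldTheory.Balaban1983to89.B12TreeDecay (K₀ K₀_pos)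
open Literature.MathematicalPhysics.QuantumFieldTheory.Balaban1983to89.B13Resummation (locE)
open Literature.MathematicalPhysics.QuantumFieldTheory.Balaban1983to89.TreeLengthTorus (TDom tsys torusTreeLen torusTreeLen_singleton)
open Literature.MathematicalPhysics.QuantumFieldTheory.Balaban1983to89.TreeLengthTorusGeometry (tgeometry TTouch)
open Summit.QuantumFields.BalabanUV.T4Continuum.B13HistMeasurable (MeasPotFrame B13HistM)
open Summit.QuantumFields.BalabanUV.T4Continuum.B13HistWitness (toyConsts level136_toy)
open Summit.QuantumFields.BalabanUV.T4Continuum.B13Carriers (TwoRuns singleDom)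
open Summit.QuantumFields.BalabanUV.T4Continuum.B13TermCoreMass (factorMass)
open Summit.QuantumFields.BalabanUV.T4Continuum.SubstrateTwoRunsDriven (DrivenRuns)
open Summit.QuantumFields.BalabanUV.T4Continuum.SubstrateActivities (CoreLetters coreOf actOfLetters)
open Summit.QuantumFields.BalabanUV.T4Continuum.SubstrateGaussianLetters (gaussC linForm)
open Summit.QuantumFields.BalabanUV.T4Continuum.SubstrateSlotsOfRecord (ActLetters coreLettersOf)
open Summit.QuantumFields.BalabanUV.T4Continuum.NE1p.DressedSmallFieldOnCoresSlotLettersMassTorus (attachedPart_locE_le_of_coreLettersOf_factorMass_torus)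
open Summit.QuantumFields.BalabanUV.T4Continuum.NE1p.DressedSmallFieldOnCoresSlotLettersHermTorus (attachedPart_locE_le_of_coreLettersOf_herm_torus
  letterMass_eq_factorMass_at_floor)
open Summit.QuantumFields.BalabanUV.T4Continuum.NE1p.DressedSmallFieldCoresWitness (E1 Acst Acst_pos)
open Summit.QuantumFields.BalabanUV.T4Continuum.NE1p.DressedSmallFieldTorusWitness (X₀ X₀_val eq_X₀_iff hrate_torus_num)
open Literature.MathematicalPhysics.QuantumFieldTheory.Balaban1983to89.T4InputCauchyRateSpecies (ballClass)
open Literature.MathematicalPhysics.QuantumFieldTheory.Balaban1983to89.T4InputCauchyRateTermwise (TermLineAnalytic)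
open Summit.QuantumFields.BalabanUV.T4Continuum.NE1p.DressedSourceAnalyticSlotLetters (termLineAnalytic_coreLettersOf)
open Summit.QuantumFields.BalabanUV.T4Continuum.NE1p.DressedSmallFieldSlotLettersWitness
open Summit.QuantumFields.BalabanUV.T4Continuum.NE1p.DressedSmallFieldSlotLettersWitnessEnd

variable {G : Type} [GaugeGroup G] (D : DrivenRuns G)

/-! ## §8 The floor letters: `m⋆ := 1/2` IS S30 §1's margin (`hfloor` WITH EQUALITY), the centre table `[2]` IS Hermitian, `hbud` at `γ^{card}` -/

/-- The margin of the datum is EXACTLY `1/2`: `(γ − card·ϑ·R′)/2 = (2 − 1·ϑW·1)/2 = 1/2`. [folklore] -/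
theorem margin_W : ((2 : ℝ) - (Fintype.card (Fin 1) : ℝ) * ϑW * 1) / 2 = 1 / 2 := by rw [Fintype.card_fin, ϑW]; norm_num

/-- `hfloor` WITH EQUALITY at `m⋆ := 1/2`. [folklore] -/
theorem hfloor_W : ∀ (k : ℕ) (Z : D.carriers.Dom) (j : Unit), (1 / 2 : ℝ) ≤
    ((fun (_ : D.carriers.Dom) (_ : Unit) => (2 : ℝ)) Z j - Fintype.card ((mIW D) Z j) * (fun (_ : D.carriers.Dom) (_ : Unit) => ϑW) Z j *
      (fun _ : ℕ => (1 : ℝ)) k) / 2 := by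
  intro k Z j; simp only [Fintype.card_fin, ϑW]; norm_num

/-- `hent`: the centre entry bound alone (from PART 1's `hctr_W` (i)). [folklore] -/
theorem hent_W : ∀ k, ∀ g ∈ (Set.univ : Set (ℕ → ℝ)), ∀ (U : D.carriers.BgB) (Z : D.carriers.Dom) (j : Unit)
    (a : ((JcW D) Z j ⊕ (𝒵W D) Z j) → ℝ × ℝ) (ii jj : Fin 1),
    ‖linForm ((AW D) Z j).base ((AW D) Z j).rd ((ctrW D) k g U).1 a ii jj‖ ≤ (fun (_ : D.carriers.Dom) (_ : Unit) => (2 : ℝ)) Z j :=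
  fun k g hg U Z j a ii jj => ((hctr_W D) k g hg U Z j a).1 ii jj

/-- `hherm`: the centre table `[2]` IS Hermitian (a real 1×1 matrix). [folklore] -/
theorem hherm_W : ∀ k, ∀ g ∈ (Set.univ : Set (ℕ → ℝ)), ∀ (U : D.carriers.BgB) (Z : D.carriers.Dom) (j : Unit)
    (a : ((JcW D) Z j ⊕ (𝒵W D) Z j) → ℝ × ℝ), (linForm ((AW D) Z j).base ((AW D) Z j).rd ((ctrW D) k g U).1 a).IsHermitian := by
  intro k g _ U Z j a
  have h0 : ((ctrW D) k g U).1 = 0 := rfl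
  refine Matrix.IsHermitian.ext fun i i' => ?_
  rw [h0, linForm_AW, linForm_AW, mul_zero, add_zero]
  simp

/-- `hco`: the coercivity clause alone (from PART 1's `hctr_W` (iv)). [folklore] -/
theorem hco_W : ∀ k, ∀ g ∈ (Set.univ : Set (ℕ → ℝ)), ∀ (U : D.carriers.BgB) (Z : D.carriers.Dom) (j : Unit)
    (a : ((JcW D) Z j ⊕ (𝒵W D) Z j) → ℝ × ℝ) (x : (mIW D) Z j → ℂ),
    (fun (_ : D.carriers.Dom) (_ : Unit) => (2 : ℝ)) Z j * Literature.MathematicalPhysics.QuantumFieldTheory.Balaban1983to89.B5Prop11Lower.nsq x ≤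
      (star x ⬝ᵥ (linForm ((AW D) Z j).base ((AW D) Z j).rd ((ctrW D) k g U).1 a *ᵥ x)).re :=
  fun k g hg U Z j a x => ((hctr_W D) k g hg U Z j a).2.2.2 x

/-- `hbud` at the Hermitian reading's threshold `γ^{card} = 2^1 = 2`: `detBudget 1 2 ϑW 1 = 1 < 2`. [folklore] -/
theorem hbud_herm_W : ∀ (k : ℕ) (Z : D.carriers.Dom) (j : Unit),
    Summit.QuantumFields.BalabanUV.T4Continuum.SubstrateGaussianLettersBall.detBudget (Fintype.card ((mIW D) Z j))
      ((fun (_ : D.carriers.Dom) (_ : Unit) => (2 : ℝ)) Z j) ((fun (_ : D.carriers.Dom) (_ : Unit) => ϑW) Z j) ((fun _ : ℕ => (1 : ℝ)) k) <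
      (fun (_ : D.carriers.Dom) (_ : Unit) => (2 : ℝ)) Z j ^ Fintype.card ((mIW D) Z j) := by
  intro k Z j
  simp only [Fintype.card_fin, Summit.QuantumFields.BalabanUV.T4Continuum.SubstrateGaussianLettersBall.detBudget, ϑW]; norm_num

/-! ## §9 ROW NE5's `TermLineAnalytic` SHAPE INHABITED AT THE LETTERS OF RECORD: S46 §1 FIRES on the datum (typer R-T133 (i) O-g15 (c)) -/

/-- **S46 §1 `termLineAnalytic_coreLettersOf` FIRES** [decided toy]: for every driven two-run object `D`, the factor activities of record
`actOfLetters (PW D) ℂ … (coreLettersOf … (AW D)) p.1 p.2` are row NE5's `TermLineAnalytic` on the ball class of the centres `ctrW` (radii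
`ROp := 1∕2`, `RHist := 2`), window `univ` — S46 §1 APPLIED ONCE BY NAME, every binder a PART 1 lemma or a one-line arithmetic term. [folklore] -/
theorem termLineAnalytic_W :
    TermLineAnalytic (ballClass (ctrW D) (fun _ : ℕ => (1 / 2 : ℝ)) (fun _ : ℕ => (2 : ℝ)))
      (fun (_ : ℕ) (p : D.carriers.Dom × Unit) (o : ℂ) (h : B13HistM (PW D)) (_ : D.carriers.Dom) =>
        actOfLetters (PW D) ℂ (𝒵W D) (domW D) (JcW D) (VW D) (ℓW D) p.1 p.2 o h) (Set.univ : Set (ℕ → ℝ)) :=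
  termLineAnalytic_coreLettersOf D (PW D) ℂ (𝒵W D) (domW D) (JcW D) (VW D) (mIW D) (AW D)
    (W := Set.univ) (ctr := (ctrW D)) (ROp := fun _ => 1 / 2) (RHist := fun _ => 2) (R' := fun _ => 1)
    (β₀ := fun _ _ => 2) (ϑ := fun _ _ => ϑW) (d₀ := fun _ _ => 2) (γ := fun _ _ => 2)
    (fun _ => by norm_num) (fun _ => zero_le_one) (hbase_W D) (hrdm_W D) (fun _ _ => by norm_num) (fun _ _ => by norm_num) (hrd_W D)
    (hctr_W D) (hbud_W D) (hmq_W D)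

section Torus
variable (N : ℕ) [NeZero N]

/-- **(B3) IN ROW NE5's `factorMass` CURRENCY AT THE FLOOR `m⋆ = 1/2` — MET AT `X₀`**: by S38 §4's located equality
`letterMass_eq_factorMass_at_floor` the factor mass of the one factor IS PART 2's letter mass (`letterMass_le`). [folklore] -/
theorem hF3_W : ∀ Z : (tsys 4 N).Dom, Z.1 ⊆ (X₀ N).1 →
    ∑ p ∈ (termsW D) N Z, factorMass (fun Z j => coreOf (PW D) ℂ (𝒵W D) (domW D) (JcW D) (VW D) (ℓW D) Z j)
        (fun Z j => gaussC ((mIW D) Z j) * Real.sqrt (max 1 ((Fintype.card ((mIW D) Z j)).factorial *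
          (fun (_ : D.carriers.Dom) (_ : Unit) => (2 : ℝ)) Z j ^ Fintype.card ((mIW D) Z j) + (fun (_ : D.carriers.Dom) (_ : Unit) => (2 : ℝ)) Z j)))
        (fun _ _ => 0) (1 / 2) (‖(0 : B13HistM (PW D))‖ + 2 * ‖(wW D)‖) p.1 p.2 ≤
      (0 + 2 * (Acst / 2)) * Real.exp (-((2 * (64 * Real.log 162) + 2) * torusTreeLen Z.1)) := by
  intro Z hZ
  have hZX : Z = X₀ N := (eq_X₀_iff N Z).1 ((Finset.Nonempty.subset_singleton_iff Z.2.1).1 hZ)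
  subst hZX
  rw [termsW_X₀, Finset.sum_singleton, ← letterMass_eq_factorMass_at_floor]
  simp only []
  rw [lam_real_univ, wB_core, N₁_core, d_Z₀, level136_toy, mul_one, norm_zero, finrank_euclideanSpace, Fintype.card_fin, Nat.cast_one,
    Nat.factorial_one, Nat.cast_one, one_mul]
  have hd : torusTreeLen (X₀ N).1 = 0 := by rw [X₀_val]; exact torusTreeLen_singleton 0
  rw [hd, mul_zero, neg_zero, Real.exp_zero]
  unfold gaussC
  rw [Fintype.card_fin]
  have h := (letterMass_le D)
  rw [show ((2 : ℝ) - 1 * ϑW * 1) / 2 = 1 / 2 by rw [ϑW]; norm_num] at h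
  simp only [Summit.QuantumFields.BalabanUV.T4Continuum.B13TermContours.wB₁, mul_one, one_mul, zero_add, pow_one, Real.exp_zero] at h ⊢
  exact h

/-- The same with the Hermitian reading's N₀ letter `√(max 1 (card!·β₀^{card} + γ^{card}))` (`γ^{card} = 2^1 = 2 = d₀`: the same number). [folklore] -/
theorem hF3_herm_W : ∀ Z : (tsys 4 N).Dom, Z.1 ⊆ (X₀ N).1 →
    ∑ p ∈ (termsW D) N Z, factorMass (fun Z j => coreOf (PW D) ℂ (𝒵W D) (domW D) (JcW D) (VW D) (ℓW D) Z j)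
        (fun Z j => gaussC ((mIW D) Z j) * Real.sqrt (max 1 ((Fintype.card ((mIW D) Z j)).factorial *
          (fun (_ : D.carriers.Dom) (_ : Unit) => (2 : ℝ)) Z j ^ Fintype.card ((mIW D) Z j) +
          (fun (_ : D.carriers.Dom) (_ : Unit) => (2 : ℝ)) Z j ^ Fintype.card ((mIW D) Z j))))
        (fun _ _ => 0) (1 / 2) (‖(0 : B13HistM (PW D))‖ + 2 * ‖(wW D)‖) p.1 p.2 ≤
      (0 + 2 * (Acst / 2)) * Real.exp (-((2 * (64 * Real.log 162) + 2) * torusTreeLen Z.1)) := by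
  intro Z hZ
  have h := hF3_W D N Z hZ
  simp only [Fintype.card_fin, pow_one] at h ⊢
  exact h

open Classical in
/-- **S36 §1 FIRES ON THE SAME DATUM — (B3) IN THE `factorMass` CURRENCY AT THE FLOOR** [decided toy]:
`attachedPart_locE_le_of_coreLettersOf_factorMass_torus D (PW D) ℂ … (AW D)` APPLIED ONCE BY NAME with `m⋆ := 1/2` (`hfloor_W` WITH EQUALITY),
`hF3_W`, and otherwise PART 2's binders; conclusion LITERALLY PART 2's. [folklore] -/
theorem slotLettersMassEnd_fires_torus (U : D.carriers.BgB) (k : ℕ) :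
    ‖locE (Dom := (tsys 4 N).Dom) (TTouch (d := 4) (N := N)) (fun Z : (tsys 4 N).Dom => Z.1) ((actSW D) N ((0 : B13HistM (PW D)) + (wW D)))
          (X₀ N).1 -
        locE (Dom := (tsys 4 N).Dom) (TTouch (d := 4) (N := N)) (fun Z : (tsys 4 N).Dom => Z.1) ((actSW D) N 0) (X₀ N).1‖ ≤
      4 * (Real.exp 1 * 9 * 64 * K₀ 64 8 ^ 2) * (Acst / 2) * Real.exp (-(0 * torusTreeLen (X₀ N).1)) :=
  attachedPart_locE_le_of_coreLettersOf_factorMass_torus D (PW D) ℂ (𝒵W D) (domW D) (JcW D) (VW D) (mIW D) (AW D)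
    (W := Set.univ) (ctr := (ctrW D)) (ROp := fun _ => 1 / 2) (RHist := fun _ => 2) (R' := fun _ => 1)
    (β₀ := fun _ _ => 2) (ϑ := fun _ _ => ϑW) (d₀ := fun _ _ => 2) (γ := fun _ _ => 2) (mstar := 1 / 2)
    (fun _ => by norm_num) (fun _ => zero_le_one) (hbase_W D) (hrdm_W D) (fun _ _ => by norm_num) (fun _ _ => by norm_num) (hrd_W D)
    (hctr_W D) (hbud_W D) (by norm_num) (hfloor_W D)
    (k := k) (g := fun _ => 0) (Set.mem_univ _) (U := U) (o := 0) (h₀ := 0) (w := (wW D)) (ϱ := 2)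
    (by show ‖(0 : ℂ) - 0‖ ≤ 1 / 2; simp)
    (by show ‖(0 : B13HistM (PW D)) - 0‖ + 2 * ‖(wW D)‖ ≤ 2; rw [sub_zero, norm_zero, zero_add]; linarith [(norm_wW_le D), sW_le])
    (emb := fun _ => D.mkDom k (singleDom 0)) (fun _ => rfl) ((termsW D) N)
    (A₀ := 0) (A₁ := Acst / 2) (R := 2 * (64 * Real.log 162) + 2) (r₁ := 0) (X₀ N)
    le_rfl (by have := Acst_pos; positivity) le_rfl hrate_torus_num hsmall_W (hF3_W D N) le_rfl (by have := Acst_pos; linarith)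

open Classical in
/-- **S38 §1 FIRES ON THE SAME DATUM — THE HERMITIAN CENTRE READING** [decided toy]: `attachedPart_locE_le_of_coreLettersOf_herm_torus D (PW D) ℂ …
(AW D)` APPLIED ONCE BY NAME: the centre table `[2]` IS Hermitian (`hherm_W`), entry bound `hent_W` and coercivity `hco_W` read off PART 1's
`hctr_W`, `hbud_herm_W` at `γ^{card} = 2`, the floor `m⋆ := 1/2`, `hF3_W` (N₀ letter with `γ^{card} = 2 = d₀`, the same number). [folklore] -/
theorem slotLettersHermEnd_fires_torus (U : D.carriers.BgB) (k : ℕ) :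
    ‖locE (Dom := (tsys 4 N).Dom) (TTouch (d := 4) (N := N)) (fun Z : (tsys 4 N).Dom => Z.1) ((actSW D) N ((0 : B13HistM (PW D)) + (wW D)))
          (X₀ N).1 -
        locE (Dom := (tsys 4 N).Dom) (TTouch (d := 4) (N := N)) (fun Z : (tsys 4 N).Dom => Z.1) ((actSW D) N 0) (X₀ N).1‖ ≤
      4 * (Real.exp 1 * 9 * 64 * K₀ 64 8 ^ 2) * (Acst / 2) * Real.exp (-(0 * torusTreeLen (X₀ N).1)) :=
  attachedPart_locE_le_of_coreLettersOf_herm_torus D (PW D) ℂ (𝒵W D) (domW D) (JcW D) (VW D) (mIW D) (AW D)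
    (W := Set.univ) (ctr := (ctrW D)) (ROp := fun _ => 1 / 2) (RHist := fun _ => 2) (R' := fun _ => 1)
    (β₀ := fun _ _ => 2) (ϑ := fun _ _ => ϑW) (γ := fun _ _ => 2) (mstar := 1 / 2)
    (fun _ => by norm_num) (fun _ => zero_le_one) (hbase_W D) (hrdm_W D) (fun _ _ => by norm_num) (hrd_W D)
    (hent_W D) (hherm_W D) (hco_W D) (hbud_herm_W D) (by norm_num) (hfloor_W D)
    (k := k) (g := fun _ => 0) (Set.mem_univ _) (U := U) (o := 0) (h₀ := 0) (w := (wW D)) (ϱ := 2)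
    (by show ‖(0 : ℂ) - 0‖ ≤ 1 / 2; simp)
    (by show ‖(0 : B13HistM (PW D)) - 0‖ + 2 * ‖(wW D)‖ ≤ 2; rw [sub_zero, norm_zero, zero_add]; linarith [(norm_wW_le D), sW_le])
    (emb := fun _ => D.mkDom k (singleDom 0)) (fun _ => rfl) ((termsW D) N)
    (A₀ := 0) (A₁ := Acst / 2) (R := 2 * (64 * Real.log 162) + 2) (r₁ := 0) (X₀ N)
    le_rfl (by have := Acst_pos; positivity) le_rfl hrate_torus_num hsmall_W (hF3_herm_W D N) le_rfl (by have := Acst_pos; linarith)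

end Torus

end Summit.QuantumFields.BalabanUV.T4Continuum.NE1p.DressedSmallFieldSlotLettersWitnessMass

end
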